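import Mathlib
import Summits.MatrixMultiplication.MatrixMultiplication.Theses.FidelityWitnesses
import Summits.MatrixMultiplication.MatrixMultiplication.Theorems.FidelityThesis.Negative.SummitEquivalence
import Summits.MatrixMultiplication.MatrixMultiplication.Theorems.AsymptoticSpectrumMonotone
import Literature.Computability.AlgebraicComplexity.TensorRestrictionRank

/-!
# `FidelityWitnesses.DiagonalPowerDecayGlue` (stmt-MatrixMultiplication-14764):
# the power-scale crux implies the thesis, `DiagonalPowerDecay → FidelityThesis`

Route `MatrixMultiplication/FidelityWitnesses`, support item (glue).  `T_n = ⟨n,n,n⟩`,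
`‖T_n‖² = n³`; `DiagonalPowerDecay` says: some `C` and `δ > 0` have
`|⟨S,T_n⟩|² ≤ C·n^{3-2δ}·‖S‖²` for every `n` and every `S` of rank `≤ n²`.

Proof.  By the landed negative-lane theorem `omega_le_two_of_not_fidelityThesis`
(`Theorems/FidelityThesis/Negative/SummitEquivalence.lean`: Bini + Alder–Strassen + cone closure)
a failure of `FidelityThesis` forces `ω(ℂ) ≤ 2`, so it suffices to show
`DiagonalPowerDecay → 2 < ω(ℂ)` (`dpdGlue_two_lt_omega`).  Suppose `ω(ℂ) ≤ 2` and fix the witness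
`(C, δ)`.  Test the inequality on `⟨m,m,m⟩` ZERO-PADDED into the `n × n` format, written directly
in restriction normal form
`S x y z = Σ_{a b c} [e a = x]·[e b = y]·[e c = z]·⟨m,m,m⟩_{a b c}` (`e = castLE × castLE`), so that
`R(S) ≤ R(⟨m,m,m⟩)` is literally `TensorRestrictsTo.tensorRank_le`, while
`⟨S,T_n⟩ = ‖S‖² = m³` (`dpdGlue_body_at_emb`): whenever `R(⟨m,m,m⟩) ≤ n²` the crux gives
`m³ ≤ C·n^{3-2δ}`.  With `ω ≤ 2`, `R(⟨a,a,a⟩) ≤ C'·a^{2+1/k}` (`exists_tensorRank_matMulTensor_le_rpow`);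
choosing `k > 3/(4δ)`, `m = t^{2k}`, `n = N·t^{2k+1}` (`N ≥ C'`, so the padded tensor fits the rank
budget `n²`) yields `t^{2δ(2k+1)-3} ≤ max(C,0)·N^{3-2δ}` for every `t ≥ 1`
(`dpdGlue_real_ineq`), absurd as `t → ∞` since `2δ(2k+1) - 3 > 0`.

No new definitions (the padded tensor is a local term); `Literature` / tree theorems used:
`TensorRestrictsTo.tensorRank_le`, `Literature.CplxAlg.matMulTensor_eq_comp_castLE`,
`exists_tensorRank_matMulTensor_le_rpow`, `fidelityThesis_overlap_self`,
`fidelityThesis_normSq_matMulTensor`, `omega_le_two_of_not_fidelityThesis`.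
-/

-- the tree's namespace `Summit.MatrixMultiplication.MatrixMultiplication.…` repeats a component by design
set_option linter.dupNamespace false

namespace Summit.MatrixMultiplication.MatrixMultiplication.Theorems

open scoped BigOperators
open Filter
open Literature.Computability.AlgebraicComplexity
open Summit.MatrixMultiplication.MatrixMultiplication.Theses.FidelityWitnesses
  (DiagonalPowerDecay FidelityThesis DiagonalPowerDecayGlue)

/-! ## Reindexing along an injection -/

/-- A finite sum of a function vanishing off the image of an injection `e` is the sum along `e`.
[folklore] -/
theorem dpdGlue_sum_eq_sum_emb {α β M : Type*} [Fintype α] [Fintype β] [AddCommMonoid M]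
    {e : α → β} (hinj : Function.Injective e) (g : β → M)
    (hg : ∀ x, (∀ a, e a ≠ x) → g x = 0) :
    (∑ x, g x) = ∑ a, g (e a) := by
  symm
  refine Finset.sum_of_injOn e hinj.injOn (fun a _ => Finset.mem_coe.2 (Finset.mem_univ _))
    (fun x _ hx => hg x fun a ha => hx ⟨a, Finset.mem_coe.2 (Finset.mem_univ a), ha⟩)
    (fun _ _ => rfl)

/-! ## The padded test tensor: the crux evaluated at `⟨m,m,m⟩ ↪ (n × n format)` -/

/-- **The crux at a padded `⟨m,m,m⟩`.**  Let `e : Fin m × Fin m → Fin n × Fin n` be injective with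
`⟨n,n,n⟩ ∘ (e × e × e) = ⟨m,m,m⟩` (e.g. the coordinate embedding).  The tensor
`S x y z = Σ_{a b c} [e a = x][e b = y][e c = z]·⟨m,m,m⟩_{a b c}` (the zero-padding of `⟨m,m,m⟩`)
is a restriction of `⟨m,m,m⟩`, so `R(S) ≤ R(⟨m,m,m⟩)`, and `⟨S, ⟨n,n,n⟩⟩ = ‖S‖² = m³`; hence if
`R(⟨m,m,m⟩) ≤ n²` the body of `DiagonalPowerDecay` at `(C, δ)` and size `n` gives
`(m³)² ≤ C·n^{3-2δ}·m³`. [folklore] -/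
theorem dpdGlue_body_at_emb {C δ : ℝ} {m n : ℕ}
    (hB : ∀ S : Fin n × Fin n → Fin n × Fin n → Fin n × Fin n → ℂ, tensorRank S ≤ n ^ 2 →
      ‖∑ a, ∑ b, ∑ c, S a b c * matMulTensor ℂ n n n a b c‖ ^ 2 ≤
        C * (n : ℝ) ^ (3 - 2 * δ) * ∑ a, ∑ b, ∑ c, ‖S a b c‖ ^ 2)
    (e : Fin m × Fin m → Fin n × Fin n) (hinj : Function.Injective e)
    (hT : ∀ a b c, matMulTensor ℂ n n n (e a) (e b) (e c) = matMulTensor ℂ m m m a b c)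
    (hr : tensorRank (matMulTensor ℂ m m m) ≤ n ^ 2) :
    ((m : ℝ) ^ 3) ^ 2 ≤ C * (n : ℝ) ^ (3 - 2 * δ) * (m : ℝ) ^ 3 := by
  classical
  -- the padded tensor, in restriction normal form
  obtain ⟨S, hS⟩ : ∃ S : Fin n × Fin n → Fin n × Fin n → Fin n × Fin n → ℂ, ∀ x y z,
      S x y z = ∑ a, ∑ b, ∑ c, (if e a = x then (1 : ℂ) else 0) * (if e b = y then (1 : ℂ) else 0) *
        (if e c = z then (1 : ℂ) else 0) * matMulTensor ℂ m m m a b c :=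
    ⟨fun x y z => ∑ a, ∑ b, ∑ c, (if e a = x then (1 : ℂ) else 0) *
      (if e b = y then (1 : ℂ) else 0) * (if e c = z then (1 : ℂ) else 0) *
        matMulTensor ℂ m m m a b c, fun _ _ _ => rfl⟩
  -- rank: `S` is a restriction of `⟨m,m,m⟩`
  have hRank : tensorRank S ≤ tensorRank (matMulTensor ℂ m m m) :=
    TensorRestrictsTo.tensorRank_le ⟨fun x a => if e a = x then (1 : ℂ) else 0,
      fun y b => if e b = y then (1 : ℂ) else 0, fun z c => if e c = z then (1 : ℂ) else 0, hS⟩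
  -- values on the box
  have hOn : ∀ a b c, S (e a) (e b) (e c) = matMulTensor ℂ m m m a b c := by
    intro a₀ b₀ c₀
    rw [hS]
    simp only [hinj.eq_iff]
    rw [Finset.sum_eq_single a₀, Finset.sum_eq_single b₀, Finset.sum_eq_single c₀]
    · simp
    all_goals first
      | (intro i _ hi; simp [hi])
      | simp
  -- values off the box
  have hOffx : ∀ x, (∀ a, e a ≠ x) → ∀ y z, S x y z = 0 := fun x hx y z => by
    rw [hS]
    exact Finset.sum_eq_zero fun a _ => Finset.sum_eq_zero fun b _ =>
      Finset.sum_eq_zero fun c _ => by simp [hx a]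
  have hOffy : ∀ y, (∀ b, e b ≠ y) → ∀ x z, S x y z = 0 := fun y hy x z => by
    rw [hS]
    exact Finset.sum_eq_zero fun a _ => Finset.sum_eq_zero fun b _ =>
      Finset.sum_eq_zero fun c _ => by simp [hy b]
  have hOffz : ∀ z, (∀ c, e c ≠ z) → ∀ x y, S x y z = 0 := fun z hz x y => by
    rw [hS]
    exact Finset.sum_eq_zero fun a _ => Finset.sum_eq_zero fun b _ =>
      Finset.sum_eq_zero fun c _ => by simp [hz c]
  -- overlap with `⟨n,n,n⟩`: `m³`
  have hOver : (∑ x, ∑ y, ∑ z, S x y z * matMulTensor ℂ n n n x y z) = (m : ℂ) ^ 3 :=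
    calc (∑ x, ∑ y, ∑ z, S x y z * matMulTensor ℂ n n n x y z)
        = ∑ a, ∑ y, ∑ z, S (e a) y z * matMulTensor ℂ n n n (e a) y z :=
          dpdGlue_sum_eq_sum_emb hinj _ fun x hx => by
            simp only [hOffx x hx, zero_mul, Finset.sum_const_zero]
      _ = ∑ a, ∑ b, ∑ z, S (e a) (e b) z * matMulTensor ℂ n n n (e a) (e b) z :=
          Finset.sum_congr rfl fun a _ => dpdGlue_sum_eq_sum_emb hinj _ fun y hy => by
            simp only [hOffy y hy, zero_mul, Finset.sum_const_zero]
      _ = ∑ a, ∑ b, ∑ c, S (e a) (e b) (e c) * matMulTensor ℂ n n n (e a) (e b) (e c) :=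
          Finset.sum_congr rfl fun a _ => Finset.sum_congr rfl fun b _ =>
            dpdGlue_sum_eq_sum_emb hinj _ fun z hz => by
              simp only [hOffz z hz, zero_mul]
      _ = ∑ a, ∑ b, ∑ c, matMulTensor ℂ m m m a b c * matMulTensor ℂ m m m a b c := by
          simp only [hOn, hT]
      _ = (m : ℂ) ^ 3 := fidelityThesis_overlap_self m
  -- squared norm: `m³`
  have hNorm : (∑ x, ∑ y, ∑ z, ‖S x y z‖ ^ 2) = (m : ℝ) ^ 3 :=
    calc (∑ x, ∑ y, ∑ z, ‖S x y z‖ ^ 2)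
        = ∑ a, ∑ y, ∑ z, ‖S (e a) y z‖ ^ 2 :=
          dpdGlue_sum_eq_sum_emb hinj _ fun x hx => by simp [hOffx x hx]
      _ = ∑ a, ∑ b, ∑ z, ‖S (e a) (e b) z‖ ^ 2 :=
          Finset.sum_congr rfl fun a _ => dpdGlue_sum_eq_sum_emb hinj _ fun y hy => by
            simp [hOffy y hy]
      _ = ∑ a, ∑ b, ∑ c, ‖S (e a) (e b) (e c)‖ ^ 2 :=
          Finset.sum_congr rfl fun a _ => Finset.sum_congr rfl fun b _ =>
            dpdGlue_sum_eq_sum_emb hinj _ fun z hz => by simp [hOffz z hz]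
      _ = ∑ a, ∑ b, ∑ c, ‖matMulTensor ℂ m m m a b c‖ ^ 2 := by simp only [hOn]
      _ = (m : ℝ) ^ 3 := fidelityThesis_normSq_matMulTensor m
  -- the body at `S`
  have key := hB S (hRank.trans hr)
  rw [hOver, hNorm, norm_pow, Complex.norm_natCast] at key
  exact key

/-- **The crux at the coordinate padding of `⟨m,m,m⟩`** (`m ≤ n`, `R(⟨m,m,m⟩) ≤ n²`):
`(m³)² ≤ C·n^{3-2δ}·m³`. [folklore] -/
theorem dpdGlue_body_at_pad {C δ : ℝ} {m n : ℕ}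
    (hB : ∀ S : Fin n × Fin n → Fin n × Fin n → Fin n × Fin n → ℂ, tensorRank S ≤ n ^ 2 →
      ‖∑ a, ∑ b, ∑ c, S a b c * matMulTensor ℂ n n n a b c‖ ^ 2 ≤
        C * (n : ℝ) ^ (3 - 2 * δ) * ∑ a, ∑ b, ∑ c, ‖S a b c‖ ^ 2)
    (h : m ≤ n) (hr : tensorRank (matMulTensor ℂ m m m) ≤ n ^ 2) :
    ((m : ℝ) ^ 3) ^ 2 ≤ C * (n : ℝ) ^ (3 - 2 * δ) * (m : ℝ) ^ 3 :=
  dpdGlue_body_at_emb hB (Prod.map (Fin.castLE h) (Fin.castLE h))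
    ((Fin.castLE_injective h).prodMap (Fin.castLE_injective h))
    (fun a b c => by rw [Literature.CplxAlg.matMulTensor_eq_comp_castLE ℂ h]) hr

/-! ## The exponent bookkeeping -/

/-- Real-number bookkeeping: from `((x^{2k})³)² ≤ C·(N·x^{2k+1})^{3-2δ}·(x^{2k})³` (`x > 0`,
`N ≥ 0`) conclude `x^{2δ(2k+1)-3} ≤ max(C,0)·N^{3-2δ}`. [folklore] -/
theorem dpdGlue_real_ineq {C δ x N : ℝ} {k : ℕ} (hx : 0 < x) (hN : 0 ≤ N)
    (h : ((x ^ (2 * k)) ^ 3) ^ 2 ≤ C * (N * x ^ (2 * k + 1)) ^ (3 - 2 * δ) * (x ^ (2 * k)) ^ 3) :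
    x ^ (2 * δ * (2 * (k : ℝ) + 1) - 3) ≤ max C 0 * N ^ (3 - 2 * δ) := by
  have h0 : (0 : ℝ) < (x ^ (2 * k)) ^ 3 := by positivity
  have h' : (x ^ (2 * k)) ^ 3 ≤ max C 0 * (N * x ^ (2 * k + 1)) ^ (3 - 2 * δ) := by
    have h1 := h.trans (mul_le_mul_of_nonneg_right
      (mul_le_mul_of_nonneg_right (le_max_left C 0) (Real.rpow_nonneg (by positivity) _)) h0.le)
    rw [sq] at h1
    exact le_of_mul_le_mul_right h1 h0
  rw [Real.mul_rpow hN (by positivity), ← Real.rpow_natCast x (2 * k + 1),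
    ← Real.rpow_mul hx.le] at h'
  have e1 : (x ^ (2 * k)) ^ 3 = x ^ ((6 * k : ℕ) : ℝ) := by
    rw [Real.rpow_natCast]; ring
  rw [e1] at h'
  rw [show 2 * δ * (2 * (k : ℝ) + 1) - 3 = ((6 * k : ℕ) : ℝ) - ((2 * k + 1 : ℕ) : ℝ) * (3 - 2 * δ) by
      push_cast; ring,
    Real.rpow_sub hx, div_le_iff₀ (Real.rpow_pos_of_pos hx _)]
  calc x ^ ((6 * k : ℕ) : ℝ) ≤ max C 0 * (N ^ (3 - 2 * δ) * x ^ (((2 * k + 1 : ℕ) : ℝ) * (3 - 2 * δ))) := h'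
    _ = max C 0 * N ^ (3 - 2 * δ) * x ^ (((2 * k + 1 : ℕ) : ℝ) * (3 - 2 * δ)) := by ring

/-! ## `DiagonalPowerDecay → 2 < ω(ℂ)` and the glue -/

/-- **The power-scale crux forces `ω(ℂ) > 2`.**  If `ω(ℂ) ≤ 2` then `R(⟨a,a,a⟩) ≤ C'·a^{2+1/k}`
(`exists_tensorRank_matMulTensor_le_rpow`); with `k > 3/(4δ)`, `m = t^{2k}`, `n = N·t^{2k+1}`
(`N ≥ max(C',1)`) the padded `⟨m,m,m⟩` fits the rank budget `n²` and the crux gives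
`t^{2δ(2k+1)-3} ≤ max(C,0)·N^{3-2δ}` for all `t ≥ 1`, absurd. [folklore] -/
theorem dpdGlue_two_lt_omega (hD : DiagonalPowerDecay) : 2 < omega ℂ := by
  obtain ⟨C, δ, hδ, hB⟩ := hD
  by_contra hω
  rw [not_lt] at hω
  obtain ⟨k, hk⟩ := exists_nat_gt (3 / (4 * δ))
  have hkpos : (0 : ℝ) < k := lt_trans (by positivity) hk
  have hk0 : (k : ℝ) ≠ 0 := hkpos.ne'
  have hγ : 0 < 2 * δ * (2 * (k : ℝ) + 1) - 3 := by
    have := (div_lt_iff₀ (by positivity : (0 : ℝ) < 4 * δ)).1 hk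
    nlinarith
  obtain ⟨C', hC', hR⟩ :=
    exists_tensorRank_matMulTensor_le_rpow ℂ (δ := 1 / (k : ℝ)) (one_div_pos.2 hkpos)
  obtain ⟨N, hN1, hNC⟩ : ∃ N : ℕ, 1 ≤ N ∧ C' ≤ N :=
    ⟨⌈C'⌉₊ + 1, by omega, by push_cast; linarith [Nat.le_ceil C']⟩
  have hN0 : (0 : ℝ) ≤ N := Nat.cast_nonneg N
  have hN1' : (1 : ℝ) ≤ N := by exact_mod_cast hN1
  -- the key inequality, for every `t ≥ 1`
  have key : ∀ t : ℕ, 1 ≤ t →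
      (t : ℝ) ^ (2 * δ * (2 * (k : ℝ) + 1) - 3) ≤ max C 0 * (N : ℝ) ^ (3 - 2 * δ) := by
    intro t ht
    have ht0 : (0 : ℝ) < t := by exact_mod_cast ht
    have hm1 : 1 ≤ t ^ (2 * k) := Nat.one_le_pow _ _ ht
    have hmn : t ^ (2 * k) ≤ N * t ^ (2 * k + 1) :=
      (Nat.pow_le_pow_right ht (Nat.le_succ _)).trans (Nat.le_mul_of_pos_left _ hN1)
    have hrank : tensorRank (matMulTensor ℂ (t ^ (2 * k)) (t ^ (2 * k)) (t ^ (2 * k))) ≤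
        (N * t ^ (2 * k + 1)) ^ 2 := by
      have h1 := hR (t ^ (2 * k)) hm1
      have hm1' : (1 : ℝ) ≤ ((t ^ (2 * k) : ℕ) : ℝ) := by exact_mod_cast hm1
      have h2 : ((t ^ (2 * k) : ℕ) : ℝ) ^ (omega ℂ + 1 / (k : ℝ)) ≤
          ((t ^ (2 * k) : ℕ) : ℝ) ^ ((2 : ℝ) + 1 / (k : ℝ)) :=
        Real.rpow_le_rpow_of_exponent_le hm1' (by linarith)
      have h3 : ((t ^ (2 * k) : ℕ) : ℝ) ^ ((2 : ℝ) + 1 / (k : ℝ)) = (t : ℝ) ^ (4 * k + 2) := by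
        push_cast
        rw [← Real.rpow_natCast (t : ℝ) (2 * k), ← Real.rpow_mul ht0.le,
          ← Real.rpow_natCast (t : ℝ) (4 * k + 2)]
        congr 1
        push_cast
        field_simp
        ring
      have h4 : (tensorRank (matMulTensor ℂ (t ^ (2 * k)) (t ^ (2 * k)) (t ^ (2 * k))) : ℝ) ≤
          (((N * t ^ (2 * k + 1)) ^ 2 : ℕ) : ℝ) :=
        calc (tensorRank (matMulTensor ℂ (t ^ (2 * k)) (t ^ (2 * k)) (t ^ (2 * k))) : ℝ)
            ≤ C' * ((t ^ (2 * k) : ℕ) : ℝ) ^ (omega ℂ + 1 / (k : ℝ)) := h1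
          _ ≤ C' * (t : ℝ) ^ (4 * k + 2) := by
              rw [← h3]; exact mul_le_mul_of_nonneg_left h2 hC'.le
          _ ≤ (N : ℝ) * (t : ℝ) ^ (4 * k + 2) := mul_le_mul_of_nonneg_right hNC (by positivity)
          _ ≤ (N : ℝ) ^ 2 * (t : ℝ) ^ (4 * k + 2) :=
              mul_le_mul_of_nonneg_right (by nlinarith) (by positivity)
          _ = (((N * t ^ (2 * k + 1)) ^ 2 : ℕ) : ℝ) := by push_cast; ring
      exact_mod_cast h4
    have body := dpdGlue_body_at_pad (hB (N * t ^ (2 * k + 1))) hmn hrank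
    push_cast at body
    exact dpdGlue_real_ineq ht0 hN0 body
  have hlim := (tendsto_rpow_atTop hγ).comp tendsto_natCast_atTop_atTop
  obtain ⟨t, ht1, ht2⟩ :=
    ((hlim.eventually_gt_atTop (max C 0 * (N : ℝ) ^ (3 - 2 * δ))).and (eventually_ge_atTop 1)).exists
  exact absurd (key t ht2) (not_le.2 ht1)

/-- **Settles `stmt-MatrixMultiplication-14764`** (`DiagonalPowerDecayGlue`, route
`FidelityWitnesses`): the power-scale crux implies the thesis, `DiagonalPowerDecay → FidelityThesis`
— a failure of the thesis would force `ω(ℂ) ≤ 2` (`omega_le_two_of_not_fidelityThesis`, Bini +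
Alder–Strassen), contradicting `dpdGlue_two_lt_omega`. [folklore] -/
theorem diagonalPowerDecayGlue_proof :
    Summit.MatrixMultiplication.MatrixMultiplication.Theses.FidelityWitnesses.DiagonalPowerDecayGlue := by
  unfold Summit.MatrixMultiplication.MatrixMultiplication.Theses.FidelityWitnesses.DiagonalPowerDecayGlue
  intro hD
  by_contra hX
  have h1 := dpdGlue_two_lt_omega hD
  have h2 := omega_le_two_of_not_fidelityThesis hX
  linarith

end Summit.MatrixMultiplication.MatrixMultiplication.Theorems
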